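import Summits.Parity.GeneralizedHardyLittlewood.Theorems.LiouvilleShiftedTablesDefs
import Summits.Parity.GeneralizedHardyLittlewood.Theorems.TypeI2Dilated.Negative.LogPowerBias
import Literature.NumberTheory.Sieve.DivisorPowerSums
import Literature.NumberTheory.Sieve.FouvryTenenbaumLiouvilleProofs
import Literature.NumberTheory.Sieve.DispersionAssemblyLemmas

/-!
# Bombieri–Vinogradov for `λ` in family form (line `peel-to-drappeau`, crux `TypeI2Dilated`)

Route `LiouvilleShiftedTables` (Parity / GeneralizedHardyLittlewood).  The route decl `BVLiouville`
(`Summit.Parity.GeneralizedHardyLittlewood.Theses.LiouvilleShiftedTables.BVLiouville`) bounds, for every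
`ε, A > 0` and all large `x`, ONE class sum per modulus:
`∑_{d ≤ x^{1/2-ε}} |∑_{n ≤ y_d/d} λ(d n + c_d)| ≤ C x/(log x)^A` for arbitrary choice functions
`c_d ∈ [0, d)`, `y_d ∈ [0, x]`.

The main theorem `family_bv` of this file is the FAMILY FORM used by the main-term assembly: a finite family
`(M i, z i, H i)_{i ∈ T}` of moduli `1 ≤ M i ≤ x^{1/2-ε}`, classes `z i (mod M i)` and heights `H i ≤ x`, in
which a modulus `m` occurs at most `τ(m)^k` times, satisfies
`∑_{i ∈ T} |∑_{t ≤ H i, t ≡ z i (M i)} λ(t)| ≤ C x/(log x)^A`.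

Proof (classical).
1. One class (`FamilyBV.abs_clsSum_le_one_add`): with `a = z % m` and `U = (H - a)/m`, the class
   `t ≡ z (mod m)`, `1 ≤ t ≤ H` consists of `t = a` (at most one term) and `t = m n + a`, `1 ≤ n ≤ U`, so
   `|class sum| ≤ 1 + |∑_{n ≤ U} λ(m n + a)|`, a `BVLiouville` summand at `(d, c_d, y_d) = (m, a, m U)`;
   and trivially `|class sum| ≤ H/m + 1` (`FamilyBV.abs_clsSum_le`).
2. Fibres (`FamilyBV.exists_perModulus`): for each modulus `m` pick a maximiser of `|class sum|` over the
   fibre `{i : M i = m}`; its value `s m` satisfies both bounds of 1, and the fibre contributes `≤ τ(m)^k s m`.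
3. Cauchy–Schwarz: `∑_m τ(m)^k s m ≤ (∑_m τ(m)^{2k} s m)^{1/2} (∑_m s m)^{1/2}`, where
   `∑_{m ≤ D} τ(m)^{2k} s m ≤ 2x ∑_{m ≤ D} τ(m)^{2k}/m ≤ 2 C_{2k} x (log x)^{2^{2k+1}}`
   (`Literature.NumberTheory.Sieve.exists_sum_sigma_zero_pow_div_le`) and
   `∑_{m ≤ D} s m ≤ D + C_b x/(log x)^{A'}` by `BVLiouville` at `(ε, A')`, `A' = 2A + 2^{2k+1}`;
   `D ≤ x^{1/2} ≤ x/(log x)^{A'}` for large `x` (`Negative.exists_log_rpow_le`).  The product is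
   `(2 C_{2k} (1 + |C_b|))^{1/2} x/(log x)^A`.
[this line: Lines/peel-to-drappeau.md]
-/

noncomputable section

namespace Summit.Parity.GeneralizedHardyLittlewood.Cruxes.TypeI2Dilated.PeelToDrappeau

open Finset Real
open scoped ArithmeticFunction.sigma
open Literature.NumberTheory.Sieve
open Summit.Parity.GeneralizedHardyLittlewood.Theses.LiouvilleShiftedTables (BVLiouville)

namespace FamilyBV

/-! ### One residue class -/

/-- The class sum `∑_{1 ≤ t ≤ Hh, t ≡ z (mod m)} λ(t)` (the summand of the family form). [this line] -/
def clsSum (m z Hh : ℕ) : ℝ :=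
  ∑ t ∈ (Icc 1 Hh).filter (fun t : ℕ => (t : ZMod m) = ((z : ℕ) : ZMod m)),
    (ArithmeticFunction.liouville t : ℝ)

/-- `|λ(n)| ≤ 1` (`λ(0) = 0`). [folklore] -/
theorem abs_liouville_le_one (n : ℕ) : |(ArithmeticFunction.liouville n : ℝ)| ≤ 1 := by
  rcases eq_or_ne n 0 with rfl | hn
  · simp
  · rw [ArithmeticFunction.liouville_apply hn]
    push_cast
    rw [abs_pow, abs_neg, abs_one, one_pow]

/-- `|∑_{t ∈ s} λ(t)| ≤ #s`. [folklore] -/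
theorem abs_sum_liouville_le_card (s : Finset ℕ) :
    |∑ t ∈ s, (ArithmeticFunction.liouville t : ℝ)| ≤ s.card := by
  calc |∑ t ∈ s, (ArithmeticFunction.liouville t : ℝ)|
      ≤ ∑ t ∈ s, |(ArithmeticFunction.liouville t : ℝ)| := Finset.abs_sum_le_sum_abs _ _
    _ ≤ ∑ _t ∈ s, (1 : ℝ) := Finset.sum_le_sum fun t _ => abs_liouville_le_one t
    _ = s.card := by simp

/-- Trivial bound: `|∑_{t ≤ Hh, t ≡ z (m)} λ(t)| ≤ Hh/m + 1`. [folklore] -/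
theorem abs_clsSum_le (m z Hh : ℕ) : |clsSum m z Hh| ≤ (Hh : ℝ) / m + 1 := by
  unfold clsSum
  refine (abs_sum_liouville_le_card _).trans ?_
  calc (((Icc 1 Hh).filter (fun t : ℕ => (t : ZMod m) = ((z : ℕ) : ZMod m))).card : ℝ)
      ≤ ((Hh / m + 1 : ℕ) : ℝ) := by
        exact_mod_cast FTLiouville.card_filter_natCast_eq_le ((z : ℕ) : ZMod m) Hh
    _ ≤ (Hh : ℝ) / m + 1 := by
        push_cast
        gcongr
        exact Nat.cast_div_le

/-- The class `t ≡ z (mod m)` is the class `t ≡ z % m [MOD m]`. [folklore] -/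
theorem filter_natCast_eq (m z Hh : ℕ) :
    (Icc 1 Hh).filter (fun t : ℕ => (t : ZMod m) = ((z : ℕ) : ZMod m)) =
      (Icc 1 Hh).filter (fun t : ℕ => t ≡ z % m [MOD m]) := by
  refine Finset.filter_congr fun t _ => ?_
  rw [ZMod.natCast_eq_natCast_iff]
  exact ⟨fun h => h.trans (Nat.mod_modEq z m).symm, fun h => h.trans (Nat.mod_modEq z m)⟩

/-- One class as a Bombieri–Vinogradov prefix: with `a = z % m`, `U = (Hh - a)/m`,
`|∑_{t ≤ Hh, t ≡ z (m)} λ(t)| ≤ 1 + |∑_{1 ≤ n ≤ U} λ(m n + a)|`. [folklore] -/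
theorem abs_clsSum_le_one_add {m : ℕ} (hm : 1 ≤ m) (z Hh : ℕ) :
    |clsSum m z Hh| ≤ 1 + |∑ n ∈ Icc 1 ((Hh - z % m) / m),
      (ArithmeticFunction.liouville (Int.toNat ((m : ℤ) * n + ((z % m : ℕ) : ℤ))) : ℝ)| := by
  have ha : z % m < m := Nat.mod_lt z hm
  unfold clsSum
  rw [filter_natCast_eq, DispersionAssembly.sum_Icc_filter_modEq _ hm ha]
  refine (abs_add_le _ _).trans (add_le_add ?_ (le_of_eq ?_))
  · split_ifs
    · exact abs_liouville_le_one _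
    · simp
  · refine congrArg _ (Finset.sum_congr rfl fun n _ => ?_)
    rw [← Nat.cast_mul, ← Nat.cast_add, Int.toNat_natCast]

/-! ### One modulus: the maximiser of a fibre and its Bombieri–Vinogradov data -/

/-- Per modulus `m ≥ 1`: a common bound `s` for the class sums of a finite family of classes `mod m` with
heights `≤ x`, which is `≤ x/m + 1` and `≤ 1 + (a BVLiouville summand at modulus m)` for some admissible
class `c ∈ [0, m)` and height `y ∈ [0, x]` (the data of a maximiser; `s = c = y = 0` for the empty
family). [this line] -/
theorem exists_perModulus {ι : Type*} (F : Finset ι) (z H : ι → ℕ) {m : ℕ} (hm : 1 ≤ m) {x : ℝ}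
    (hx : 0 ≤ x) (hH : ∀ i ∈ F, (H i : ℝ) ≤ x) :
    ∃ s : ℝ, ∃ c : ℤ, ∃ y : ℝ, 0 ≤ s ∧ 0 ≤ c ∧ c < m ∧ 0 ≤ y ∧ y ≤ x ∧
      (∀ i ∈ F, |clsSum m (z i) (H i)| ≤ s) ∧ s ≤ x / m + 1 ∧
      s ≤ 1 + |∑ n ∈ Icc 1 ⌊y / m⌋₊,
        (ArithmeticFunction.liouville (Int.toNat ((m : ℤ) * n + c)) : ℝ)| := by
  by_cases hne : F.Nonempty
  · obtain ⟨i, hi, hmax⟩ := Finset.exists_max_image F (fun i => |clsSum m (z i) (H i)|) hne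
    have hm0 : (m : ℝ) ≠ 0 := by positivity
    set a : ℕ := z i % m with ha
    set U : ℕ := (H i - a) / m with hU
    have hUH : m * U ≤ H i := (Nat.mul_div_le _ _).trans (Nat.sub_le _ _)
    have hy : ((m * U : ℕ) : ℝ) ≤ x := (le_trans (by exact_mod_cast hUH) (hH i hi))
    refine ⟨|clsSum m (z i) (H i)|, (a : ℤ), ((m * U : ℕ) : ℝ), abs_nonneg _, by positivity,
      by exact_mod_cast Nat.mod_lt _ hm, by positivity, hy, hmax, ?_, ?_⟩
    · refine (abs_clsSum_le _ _ _).trans ?_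
      gcongr
      exact hH i hi
    · have hfl : ⌊((m * U : ℕ) : ℝ) / m⌋₊ = U := by
        rw [Nat.cast_mul, mul_div_cancel_left₀ _ hm0, Nat.floor_natCast]
      rw [hfl]
      exact abs_clsSum_le_one_add hm _ _
  · refine ⟨0, 0, 0, le_rfl, le_rfl, by exact_mod_cast hm, le_rfl, hx, ?_, by positivity,
      by positivity⟩
    intro i hi
    exact absurd ⟨i, hi⟩ hne

/-! ### Numerics -/

/-- `√(C₁ x L^P) · √(C₂ x / L^{2A+P}) = √(C₁ C₂) · x / L^A` for `L > 0`, `x ≥ 0`. [folklore] -/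
theorem sqrt_mul_sqrt_eq {C₁ C₂ x L A : ℝ} (P : ℕ) (hC₁ : 0 ≤ C₁) (hC₂ : 0 ≤ C₂) (hx : 0 ≤ x)
    (hL : 0 < L) :
    Real.sqrt (C₁ * x * L ^ P) * Real.sqrt (C₂ * x / L ^ (2 * A + P)) =
      Real.sqrt (C₁ * C₂) * x / L ^ A := by
  have hP1 : 0 ≤ C₁ * x * L ^ P := by positivity
  rw [← Real.sqrt_mul hP1]
  have hLsplit : L ^ (2 * A + P) = (L ^ A) ^ 2 * L ^ P := by
    rw [show (2 : ℝ) * A + (P : ℝ) = A + A + (P : ℝ) by ring, Real.rpow_add hL, Real.rpow_add hL,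
      Real.rpow_natCast]
    ring
  have hLA0 : L ^ A ≠ 0 := (Real.rpow_pos_of_pos hL A).ne'
  have hLP : L ^ P ≠ 0 := pow_ne_zero _ hL.ne'
  have hsq : C₁ * x * L ^ P * (C₂ * x / L ^ (2 * A + P)) =
      (Real.sqrt (C₁ * C₂) * x / L ^ A) ^ 2 := by
    rw [hLsplit, div_pow, mul_pow, Real.sq_sqrt (by positivity)]
    field_simp
  rw [hsq, Real.sqrt_sq (by positivity)]

end FamilyBV

open FamilyBV in
/-- **Bombieri–Vinogradov for `λ` in family form.**  From `BVLiouville`: for `0 < ε ≤ 1/4`, `A > 0`, `k`,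
there are `C ≥ 0` and `x₀` such that for `x ≥ x₀` and every finite family `(M i, z i, H i)_{i ∈ T}` with
`1 ≤ M i ≤ x^{1/2-ε}`, `H i ≤ x` and multiplicities `#{i : M i = m} ≤ τ(m)^k`,
`∑_{i ∈ T} |∑_{t ≤ H i, t ≡ z i (M i)} λ(t)| ≤ C x/(log x)^A`. [this line] -/
theorem family_bv (hBV : BVLiouville) {ε : ℝ} (hε : 0 < ε) (_hε1 : ε ≤ 1 / 4) {A : ℝ} (hA : 0 < A)
    (k : ℕ) :
    ∃ C x₀ : ℝ, 0 ≤ C ∧ ∀ x : ℝ, x₀ ≤ x →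
      ∀ {ι : Type} (T : Finset ι) (M z H : ι → ℕ),
        (∀ i ∈ T, 1 ≤ M i ∧ (M i : ℝ) ≤ x ^ (1 / 2 - ε) ∧ (H i : ℝ) ≤ x) →
        (∀ m : ℕ, ((T.filter (fun i => M i = m)).card : ℝ) ≤ (σ 0 m : ℝ) ^ k) →
        ∑ i ∈ T, |∑ t ∈ (Icc 1 (H i)).filter
            (fun t : ℕ => (t : ZMod (M i)) = ((z i : ℕ) : ZMod (M i))),
            (ArithmeticFunction.liouville t : ℝ)| ≤ C * x / Real.log x ^ A := by
  -- constants
  obtain ⟨C₁, hC₁, h1⟩ := exists_sum_sigma_zero_pow_div_le (2 * k)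
  set P : ℕ := 2 ^ (2 * k + 1) with hP
  obtain ⟨Cb, xb, hb⟩ := hBV ε hε (2 * A + P) (by positivity)
  obtain ⟨X₁, hX₁⟩ :=
    Negative.exists_log_rpow_le (2 * A + P) (s := 1 / 2) (K := 1) (by norm_num) one_pos
  set K₀ : ℝ := Real.sqrt (2 * C₁ * (1 + |Cb|)) with hK₀
  refine ⟨K₀, max (max xb X₁) 3, Real.sqrt_nonneg _, ?_⟩
  intro x hx ι T M z H hT hcard
  -- unpack `x ≥ x₀`
  have hxb : xb ≤ x := ((le_max_left _ _).trans (le_max_left _ _)).trans hx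
  have hX₁x : X₁ ≤ x := ((le_max_right _ _).trans (le_max_left _ _)).trans hx
  have hx3 : 3 ≤ x := (le_max_right _ _).trans hx
  have hx1 : 1 ≤ x := by linarith
  have hx0 : 0 < x := by linarith
  have hL1 : 1 ≤ Real.log x := DispersionAssembly.log_one_le_of_three_le hx3
  have hL0 : 0 < Real.log x := by linarith
  show ∑ i ∈ T, |clsSum (M i) (z i) (H i)| ≤ K₀ * x / Real.log x ^ A
  -- per-modulus choices: the bound `s m`, the class `c m`, the height `y m`
  have hch : ∀ m : ℕ, ∃ s : ℝ, ∃ c : ℤ, ∃ y : ℝ, (0 ≤ s ∧ 0 ≤ y ∧ y ≤ x) ∧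
      (1 ≤ m → (0 ≤ c ∧ c < m) ∧
        (∀ i ∈ T.filter (fun i => M i = m), |clsSum (M i) (z i) (H i)| ≤ s) ∧
        s ≤ x / m + 1 ∧ s ≤ 1 + |∑ n ∈ Icc 1 ⌊y / m⌋₊,
          (ArithmeticFunction.liouville (Int.toNat ((m : ℤ) * n + c)) : ℝ)|) := by
    intro m
    rcases Nat.eq_zero_or_pos m with hm0 | hm
    · exact ⟨0, 0, 0, ⟨le_rfl, le_rfl, hx0.le⟩, fun h => by omega⟩
    · obtain ⟨s, c, y, hs, hc0, hcm, hy0, hyx, hF, hs1, hs2⟩ :=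
        exists_perModulus (T.filter (fun i => M i = m)) z H hm hx0.le
          (fun i hi => (hT i (Finset.mem_filter.1 hi).1).2.2)
      refine ⟨s, c, y, ⟨hs, hy0, hyx⟩, fun _ => ⟨⟨hc0, hcm⟩, fun i hi => ?_, hs1, hs2⟩⟩
      rw [(Finset.mem_filter.1 hi).2]
      exact hF i hi
  choose s c y hsy hP' using hch
  have hBV' := hb x hxb c y (fun d hd => (hP' d hd).1) (fun d => (hsy d).2)
  -- the range of moduli
  set D : ℕ := ⌊x ^ (1 / 2 - ε)⌋₊ with hD
  have hDle : (D : ℝ) ≤ x ^ (1 / 2 - ε) := Nat.floor_le (Real.rpow_nonneg hx0.le _)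
  have hDhalf : (D : ℝ) ≤ x ^ (1 / 2 : ℝ) :=
    hDle.trans (Real.rpow_le_rpow_of_exponent_le hx1 (by linarith))
  have hDx : (D : ℝ) ≤ x := by
    refine hDle.trans ?_
    calc x ^ (1 / 2 - ε) ≤ x ^ (1 : ℝ) := Real.rpow_le_rpow_of_exponent_le hx1 (by linarith)
      _ = x := Real.rpow_one x
  have hmaps : ∀ i ∈ T, M i ∈ Icc 1 D := by
    intro i hi
    obtain ⟨h1i, h2i, -⟩ := hT i hi
    exact Finset.mem_Icc.2 ⟨h1i, Nat.le_floor h2i⟩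
  -- multiplicity: `∑_i ≤ ∑_m τ(m)^k s(m)`
  have hmult : ∑ i ∈ T, |clsSum (M i) (z i) (H i)| ≤ ∑ m ∈ Icc 1 D, (σ 0 m : ℝ) ^ k * s m := by
    rw [← Finset.sum_fiberwise_of_maps_to hmaps]
    refine Finset.sum_le_sum fun m hm => ?_
    have hm1 : 1 ≤ m := (Finset.mem_Icc.1 hm).1
    calc ∑ i ∈ T.filter (fun i => M i = m), |clsSum (M i) (z i) (H i)|
        ≤ ∑ _i ∈ T.filter (fun i => M i = m), s m := Finset.sum_le_sum (hP' m hm1).2.1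
      _ = ((T.filter (fun i => M i = m)).card : ℝ) * s m := by rw [Finset.sum_const, nsmul_eq_mul]
      _ ≤ (σ 0 m : ℝ) ^ k * s m := mul_le_mul_of_nonneg_right (hcard m) (hsy m).1
  -- `∑_m s(m) ≤ (1 + |Cb|) x/(log x)^{2A+P}` (BVLiouville + `D ≤ x^{1/2}`)
  have hS₂ : ∑ m ∈ Icc 1 D, s m ≤ (1 + |Cb|) * x / Real.log x ^ (2 * A + P) := by
    have hLApos : 0 < Real.log x ^ (2 * A + P) := Real.rpow_pos_of_pos hL0 _
    have h1' : ∑ m ∈ Icc 1 D, s m ≤ (D : ℝ) + ∑ m ∈ Icc 1 D, |∑ n ∈ Icc 1 ⌊y m / m⌋₊,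
        (ArithmeticFunction.liouville (Int.toNat ((m : ℤ) * n + c m)) : ℝ)| := by
      calc ∑ m ∈ Icc 1 D, s m ≤ ∑ m ∈ Icc 1 D, (1 + |∑ n ∈ Icc 1 ⌊y m / m⌋₊,
            (ArithmeticFunction.liouville (Int.toNat ((m : ℤ) * n + c m)) : ℝ)|) :=
            Finset.sum_le_sum fun m hm => (hP' m (Finset.mem_Icc.1 hm).1).2.2.2
        _ = (D : ℝ) + _ := by
            rw [Finset.sum_add_distrib, Finset.sum_const, Nat.card_Icc, add_tsub_cancel_right]
            simp
    have h2' : (D : ℝ) ≤ x / Real.log x ^ (2 * A + P) := by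
      have hlog : Real.log x ^ (2 * A + P) ≤ x ^ (1 / 2 : ℝ) := by simpa using hX₁ x hX₁x
      rw [le_div_iff₀ hLApos]
      calc (D : ℝ) * Real.log x ^ (2 * A + P) ≤ x ^ (1 / 2 : ℝ) * x ^ (1 / 2 : ℝ) :=
            mul_le_mul hDhalf hlog hLApos.le (Real.rpow_nonneg hx0.le _)
        _ = x := by rw [← Real.rpow_add hx0]; norm_num
    have h3' : ∑ m ∈ Icc 1 D, |∑ n ∈ Icc 1 ⌊y m / m⌋₊,
        (ArithmeticFunction.liouville (Int.toNat ((m : ℤ) * n + c m)) : ℝ)| ≤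
          |Cb| * x / Real.log x ^ (2 * A + P) :=
      hBV'.trans (div_le_div_of_nonneg_right
        (mul_le_mul_of_nonneg_right (le_abs_self Cb) hx0.le) hLApos.le)
    calc ∑ m ∈ Icc 1 D, s m ≤ (D : ℝ) + _ := h1'
      _ ≤ x / Real.log x ^ (2 * A + P) + |Cb| * x / Real.log x ^ (2 * A + P) := add_le_add h2' h3'
      _ = (1 + |Cb|) * x / Real.log x ^ (2 * A + P) := by ring
  -- `∑_m τ(m)^{2k} s(m) ≤ 2 C₁ x (log x)^P` (trivial bound + divisor power sums)
  have hS₁ : ∑ m ∈ Icc 1 D, (σ 0 m : ℝ) ^ (2 * k) * s m ≤ 2 * C₁ * x * Real.log x ^ P := by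
    set Dn : ℕ := max D 2 with hDn
    have hDn2 : 2 ≤ Dn := le_max_right _ _
    have hsub : Icc 1 D ⊆ Icc 1 Dn := Finset.Icc_subset_Icc le_rfl (le_max_left _ _)
    have hDnx : (Dn : ℝ) ≤ x := by
      rw [hDn, Nat.cast_max]
      exact max_le hDx (by norm_num; linarith)
    have hDn0 : (0 : ℝ) < Dn := by positivity
    have hlogDn : Real.log Dn ≤ Real.log x := Real.log_le_log hDn0 hDnx
    have hlogDn0 : 0 ≤ Real.log Dn := Real.log_nonneg (by exact_mod_cast (show 1 ≤ Dn by omega))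
    have htriv : ∀ m ∈ Icc 1 D, s m ≤ 2 * x / m := by
      intro m hm
      have hm1 : 1 ≤ m := (Finset.mem_Icc.1 hm).1
      have hm0 : (0 : ℝ) < m := by exact_mod_cast hm1
      have hmx : (m : ℝ) ≤ x := le_trans (by exact_mod_cast (Finset.mem_Icc.1 hm).2) hDx
      have h1m : (1 : ℝ) ≤ x / m := by rw [le_div_iff₀ hm0, one_mul]; exact hmx
      calc s m ≤ x / m + 1 := (hP' m hm1).2.2.1
        _ ≤ x / m + x / m := by linarith
        _ = 2 * x / m := by ring
    calc ∑ m ∈ Icc 1 D, (σ 0 m : ℝ) ^ (2 * k) * s m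
        ≤ ∑ m ∈ Icc 1 D, (σ 0 m : ℝ) ^ (2 * k) * (2 * x / m) :=
          Finset.sum_le_sum fun m hm => mul_le_mul_of_nonneg_left (htriv m hm) (by positivity)
      _ = 2 * x * ∑ m ∈ Icc 1 D, (σ 0 m : ℝ) ^ (2 * k) / m := by
          rw [Finset.mul_sum]
          refine Finset.sum_congr rfl fun m _ => ?_
          ring
      _ ≤ 2 * x * ∑ m ∈ Icc 1 Dn, (σ 0 m : ℝ) ^ (2 * k) / m := by
          refine mul_le_mul_of_nonneg_left ?_ (by positivity)
          exact Finset.sum_le_sum_of_subset_of_nonneg hsub fun _ _ _ => by positivity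
      _ ≤ 2 * x * (C₁ * Real.log Dn ^ P) := mul_le_mul_of_nonneg_left (h1 Dn hDn2) (by positivity)
      _ ≤ 2 * x * (C₁ * Real.log x ^ P) := by gcongr
      _ = 2 * C₁ * x * Real.log x ^ P := by ring
  -- Cauchy–Schwarz
  have hCS : ∑ m ∈ Icc 1 D, (σ 0 m : ℝ) ^ k * s m ≤ K₀ * x / Real.log x ^ A := by
    have hterm : ∀ m ∈ Icc 1 D, (σ 0 m : ℝ) ^ k * s m =
        Real.sqrt ((σ 0 m : ℝ) ^ (2 * k) * s m) * Real.sqrt (s m) := by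
      intro m _
      have hs0 := (hsy m).1
      rw [← Real.sqrt_mul (by positivity),
        show (σ 0 m : ℝ) ^ (2 * k) * s m * s m = ((σ 0 m : ℝ) ^ k * s m) ^ 2 by ring,
        Real.sqrt_sq (by positivity)]
    rw [Finset.sum_congr rfl hterm]
    refine (Real.sum_sqrt_mul_sqrt_le (Icc 1 D) (fun m => mul_nonneg (by positivity) (hsy m).1)
      (fun m => (hsy m).1)).trans ?_
    calc Real.sqrt (∑ m ∈ Icc 1 D, (σ 0 m : ℝ) ^ (2 * k) * s m) * Real.sqrt (∑ m ∈ Icc 1 D, s m)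
        ≤ Real.sqrt (2 * C₁ * x * Real.log x ^ P) *
            Real.sqrt ((1 + |Cb|) * x / Real.log x ^ (2 * A + P)) := by gcongr
      _ = Real.sqrt (2 * C₁ * (1 + |Cb|)) * x / Real.log x ^ A :=
          sqrt_mul_sqrt_eq P (by positivity) (by positivity) hx0.le hL0
  exact hmult.trans hCS

/-- Landing anchor of the main-terms chain, file 1 (family Bombieri–Vinogradov); registered stub
`mainTermsChain1_anchor` of the crux item (the mathematical content of this file is `family_bv`). -/
theorem mainTermsChain1_anchor : True := trivial

end Summit.Parity.GeneralizedHardyLittlewood.Cruxes.TypeI2Dilated.PeelToDrappeau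

end
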